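import Literature.NumberTheory.EllipticCurves.Kobayashi2003.SignedSelmer
import Literature.NumberTheory.EllipticCurves.H1CorestrictionIndexTwo
import Mathlib.RingTheory.Coprime.Lemmas
import HarnessLib

/-!
# Route `SignedLowerHalves`, crux L `SmallImageLowerHalfBothSigns` (stmt-BirchSwinnertonDyer-23599), line `rtt_w3` v10′ — brick D3-c of COUNT_π,
# W-SIDE, ABSTRACT HALF (memo `Lines/rtt_w3-MEMO-D3c-w3g17.md` §2 (D3-W-c)): QUADRATIC DESCENT OF KOBAYASHI'S KUMMER CONDITION at a place
# along an index-`2` subgroup of the local group — if a torsion-valued cocycle `ψ` is, on a subgroup `Λ' ≤ Λ = Gal(K̄_E/L_w)` with `Λ = Λ' ∪ cΛ'`,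
# the Kummer cocycle of a point `Q'` with `p^{k'}Q' ∈ A'`, then `[ψ]` satisfies Kobayashi's condition `localKummerOverOfEmb W p H ι A` on ALL of
# `Λ`, provided `A'` is `c`-stable, fixed by `Λ'`, and its `Λ`-fixed points lie in `A` (`A' = E^ε(K_{n,w})` transported into `E(K̄_E)`,
# `A = E^ε(ℚ_{n,p})`, `c` a lift of the non-trivial class of the unramified quadratic `K_{n,w}/ℚ_{n,p}`).

Width seat `bsd-line-slh-p3-w3` g17 under LEAD `cruxlead-stmt-BirchSwinnertonDyer-23599` (cell `bsd-ssimc`; `--supports stmt-BirchSwinnertonDyer-23599 --as helper`).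
THEOREMS ONLY (no definition, no named fact, no instance, no `sorry`); everything happens inside ONE local group `Λ = localSubgroupOfEmb H ι ≤ Γ_E`
of the BASE field's completion (no second completion, no base change): the concrete half of D3-W — identifying the `K`-side carrier condition at
`v ∣ p` with the hypothesis «Kummer on `Λ'` with `A'`» through the local base-change square `Γ_{K_v} → Γ_{ℚ_p}` (pattern
`Rank1Residual/Additive/LocalSubgroupTransport.transportHom/transportPoints`) — is NOT done here. BSD / crux L / COUNT are NOT proved here.

THE ARGUMENT (cocycle level, no Kummer injectivity needed; `p` odd, `p^a ψ = 0`). Let `Ψ(λ) := ι_*(ψ(λ|_{K̄}))` on `Λ` (a crossed homomorphism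
into `E(K̄_E)`, `pointsMapOfEmb_cocycle_mul`) with `Ψ(τ) = τQ' − Q'` for `τ ∈ Λ'`, `P' := p^{k'}Q' ∈ A'`.
(1) TRACE: `Q'' := Q' + cQ' − Ψ(c)` has `τQ'' − Q'' = 2Ψ(τ)` on `Λ'` (`c·Ψ(c⁻¹τc) = Ψ(τ) + τΨ(c) − Ψ(c)`), and `p^{k'+a}Q'' = p^a(P' + cP') ∈ A`
   (`P' + cP' ∈ A'` is fixed by `Λ = Λ' ∪ cΛ'`).
(2) DEFECT: `G(λ) := λQ'' − Q'' − 2Ψ(λ)` vanishes on `Λ'` and is constant `= x₀ := G(c)` on `cΛ'`; `x₀` is `Λ'`-fixed, `c x₀ = −x₀`, so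
   `2x₀ = c(−x₀) − (−x₀)` and `p^a x₀ = c(p^aQ'') − p^aQ''`; Bezout `2u + p^a w = 1` gives the `Λ'`-fixed `y := −u x₀ + w p^a Q''` with `cy − y = x₀`,
   whence `G = ∂y` on `Λ`.
(3) So `2Ψ(λ) = λ(Q'' − y) − (Q'' − y)` on `Λ`, and `Ψ = u·2Ψ` (as `p^aΨ = 0`): `Ψ(λ) = λQ − Q` with `Q := u(Q'' − y)`, `p^{k'+a}Q ∈ A`.

* `pointsMapOfEmb_cocycle_mul` — the cocycle identity of `Ψ` on `Λ`.
* ★★ `mem_localKummerOverOfEmb_of_kummer_on_index_two` — the statement above, for Kobayashi's `localKummerOverOfEmb` (the `p`-part of B. D. Kim's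
  `nonPrimitiveSignedSelmerLayer`, the W-side target of COUNT_π).

References: [Kobayashi2003] Def. 1.1; [BDKim2009] §2 p. 185; [SerreGaloisCohomology1997] I §2.6 (b), I §5.1; [MilneADT2006] I Prop. 3.8 (the
classical shadow: exact descent of `H¹(K_v, E) → H¹(L_w, E)` at an unramified good place); [DokchitserDokchitserAnnals2010] Lemma 4.14 (proof).
-/

set_option autoImplicit false
set_option linter.dupNamespace false -- D-0017: single-problem summit, the namespace repeats the problem name by design
noncomputable section

open scoped Classical

universe u

namespace Summit.BirchSwinnertonDyer.BirchSwinnertonDyer.Theorems.SmallImageCharSignedSelmer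

open Literature.NumberTheory.EllipticCurves Literature.NumberTheory.EllipticCurves.Kobayashi2003
  Literature.NumberTheory.GaloisRepresentations Field

section Descent

variable {k : Type u} [Field k] (W : WeierstrassCurve k) (p : ℕ) [hp : Fact p.Prime] (H : Subgroup (absoluteGaloisGroup k))
  {E : Type u} [Field E] [Algebra k E] (ι : AlgebraicClosure k →ₐ[k] AlgebraicClosure E)

omit hp in
/-- **The local crossed homomorphism of a torsion-valued cocycle.** For `ψ ∈ Z¹(H, E[p^∞])`, the function
`Ψ(λ) = ι_*(ψ(λ|_{K̄}))` on the local group `Λ = Gal(K̄_E/L_w)` satisfies `Ψ(λμ) = Ψ(λ) + λ•Ψ(μ)` (`ι_*` is equivariant along `λ ↦ λ|_{K̄}`,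
`pointsMapOfEmb_smul`). [cite: SerreGaloisCohomology1997, I §5.1] -/
theorem pointsMapOfEmb_cocycle_mul (ψ : contOneCocycles (discreteTopRep H (W.geomPrimaryTorsion p)))
    (x y : absoluteGaloisGroup E) (hx : x ∈ localSubgroupOfEmb H ι) (hy : y ∈ localSubgroupOfEmb H ι) (hxy : x * y ∈ localSubgroupOfEmb H ι) :
    pointsMapOfEmb W ι ((ψ.1 (resGalSubgroupOfEmb H ι ⟨x * y, hxy⟩) : W.geomPrimaryTorsion p) : W.geomPoints) =
      pointsMapOfEmb W ι ((ψ.1 (resGalSubgroupOfEmb H ι ⟨x, hx⟩) : W.geomPrimaryTorsion p) : W.geomPoints) +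
        x • pointsMapOfEmb W ι ((ψ.1 (resGalSubgroupOfEmb H ι ⟨y, hy⟩) : W.geomPrimaryTorsion p) : W.geomPoints) := by
  have hmul : resGalSubgroupOfEmb H ι ⟨x * y, hxy⟩ = resGalSubgroupOfEmb H ι ⟨x, hx⟩ * resGalSubgroupOfEmb H ι ⟨y, hy⟩ :=
    (resGalSubgroupOfEmb H ι).map_mul ⟨x, hx⟩ ⟨y, hy⟩
  rw [hmul, cocycle_mul H ψ, AddMemClass.coe_add, map_add, primaryComponent.coe_smul, resGalSubgroupOfEmb_apply_coe,
    pointsMapOfEmb_smul]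

/-- ★★ **Quadratic descent of Kobayashi's Kummer condition along an index-`2` local subgroup (D3-W, abstract half).** Let `Λ = Gal(K̄_E/L_w)` be
the local group of `H` at `ι`, `Λ' ≤ Λ` a subgroup and `c ∈ Λ` with `c² ∈ Λ'`, `c⁻¹Λ'c ⊆ Λ'` and `Λ = Λ' ∪ cΛ'`; let `A, A' ≤ E(K̄_E)` with `cA' ⊆ A'`,
`A'` fixed pointwise by `Λ'`, and every `Λ`-fixed point of `A'` in `A`. If `ψ ∈ Z¹(H, E[p^∞])` is killed by `p^a` (`p` odd) and ON `Λ'` its local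
crossed homomorphism is the Kummer cocycle `τ ↦ τQ' − Q'` of a point with `p^{k'}Q' ∈ A'`, then `[ψ] ∈ localKummerOverOfEmb W p H ι A`: on ALL of `Λ`
it is the Kummer cocycle of a point `Q` with `p^{k'+a}Q ∈ A` (trace `Q' + cQ'`, defect cocycle on `Λ/Λ' ≅ ℤ/2` killed by `2` and by `p^a`, Bezout).
In COUNT_π: `E = ℚ_p`-completion, `H = Gal(ℚ̄/ℚ_n)`, `Λ' = Gal(ℚ̄_p/K_{n,w})`, `A' = E^ε(K_{n,w})`, `A = E^ε(ℚ_{n,p})`, `c` a Frobenius of `K_v/ℚ_p`.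
[cite: Kobayashi2003, Def. 1.1] [cite: BDKim2009, §2 p. 185] [cite: SerreGaloisCohomology1997, I §2.6 (b)] [cite: MilneADT2006, I Prop. 3.8] -/
theorem mem_localKummerOverOfEmb_of_kummer_on_index_two (hp2 : p ≠ 2)
    (Λ' : Subgroup (absoluteGaloisGroup E)) (hΛ' : Λ' ≤ localSubgroupOfEmb H ι)
    {c : absoluteGaloisGroup E} (hc : c ∈ localSubgroupOfEmb H ι) (hcc : c * c ∈ Λ')
    (hnorm : ∀ x ∈ Λ', c⁻¹ * x * c ∈ Λ') (hcov : ∀ b ∈ localSubgroupOfEmb H ι, b ∈ Λ' ∨ c⁻¹ * b ∈ Λ')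
    (A A' : AddSubgroup (localPoints W E)) (hA'c : ∀ P ∈ A', c • P ∈ A') (hA'fix : ∀ P ∈ A', ∀ x ∈ Λ', x • P = P)
    (hA'A : ∀ P ∈ A', (∀ b ∈ localSubgroupOfEmb H ι, b • P = P) → P ∈ A)
    (ψ : contOneCocycles (discreteTopRep H (W.geomPrimaryTorsion p))) {a : ℕ} (ha : ∀ x : H, p ^ a • ψ.1 x = 0)
    (Q' : localPoints W E) (k' : ℕ) (hQ'A : p ^ k' • Q' ∈ A')
    (hψ : ∀ (τ : absoluteGaloisGroup E) (hτ : τ ∈ Λ'),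
      pointsMapOfEmb W ι ((ψ.1 (resGalSubgroupOfEmb H ι ⟨τ, hΛ' hτ⟩) : W.geomPrimaryTorsion p) : W.geomPoints) = τ • Q' - Q') :
    oneCocycleClass (discreteTopRep H (W.geomPrimaryTorsion p)) ψ ∈ localKummerOverOfEmb W p H ι A := by
  -- notation: the local crossed homomorphism `Ψ` and its calculus
  set Ψ : ∀ x : absoluteGaloisGroup E, x ∈ localSubgroupOfEmb H ι → localPoints W E :=
    fun x hx ↦ pointsMapOfEmb W ι ((ψ.1 (resGalSubgroupOfEmb H ι ⟨x, hx⟩) : W.geomPrimaryTorsion p) : W.geomPoints) with hΨdef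
  have Ψcongr : ∀ (x x' : absoluteGaloisGroup E) (hxx' : x = x') (hx : x ∈ localSubgroupOfEmb H ι) (hx' : x' ∈ localSubgroupOfEmb H ι),
      Ψ x hx = Ψ x' hx' := by
    intro x x' hxx' hx hx'; subst hxx'; rfl
  have Ψmul : ∀ (x y : absoluteGaloisGroup E) (hx : x ∈ localSubgroupOfEmb H ι) (hy : y ∈ localSubgroupOfEmb H ι)
      (hxy : x * y ∈ localSubgroupOfEmb H ι), Ψ (x * y) hxy = Ψ x hx + x • Ψ y hy :=
    fun x y hx hy hxy ↦ pointsMapOfEmb_cocycle_mul W p H ι ψ x y hx hy hxy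
  have hΨtors : ∀ (x : absoluteGaloisGroup E) (hx : x ∈ localSubgroupOfEmb H ι), ((p : ℤ) ^ a) • Ψ x hx = 0 := fun x hx ↦ by
    rw [← Nat.cast_pow, natCast_zsmul, hΨdef]
    dsimp only
    rw [← map_nsmul, ← AddSubmonoidClass.coe_nsmul, ha, ZeroMemClass.coe_zero, map_zero]
  have hsz : ∀ (g : absoluteGaloisGroup E) (n : ℤ) (P : localPoints W E), g • (n • P) = n • (g • P) := fun g n P ↦
    map_zsmul (DistribSMul.toAddMonoidHom (localPoints W E) g) n P
  have hcΛ : c ∈ localSubgroupOfEmb H ι := hc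
  have hcinv : ∀ (τ : absoluteGaloisGroup E), τ ∈ localSubgroupOfEmb H ι → c⁻¹ * τ * c ∈ localSubgroupOfEmb H ι :=
    fun τ hτ ↦ mul_mem (mul_mem (inv_mem hcΛ) hτ) hcΛ
  -- conjugation: `c • Ψ(c⁻¹ τ c) = Ψ τ + τ • Ψ c − Ψ c`
  have Ψconj : ∀ (τ : absoluteGaloisGroup E) (hτ : τ ∈ localSubgroupOfEmb H ι),
      c • Ψ (c⁻¹ * τ * c) (hcinv τ hτ) = Ψ τ hτ + τ • Ψ c hcΛ - Ψ c hcΛ := fun τ hτ ↦ by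
    have h1 := Ψmul c (c⁻¹ * τ * c) hcΛ (hcinv τ hτ) (mul_mem hcΛ (hcinv τ hτ))
    rw [Ψcongr (c * (c⁻¹ * τ * c)) (τ * c) (by group) _ (mul_mem hτ hcΛ), Ψmul τ c hτ hcΛ (mul_mem hτ hcΛ)] at h1
    rw [eq_sub_iff_add_eq, add_comm, ← h1]
  -- (1) the trace point `Q'' = Q' + cQ' − Ψ c`
  set tc : localPoints W E := Ψ c hcΛ with htc
  set Q'' : localPoints W E := Q' + c • Q' - tc with hQ''
  clear_value tc Q''
  have hQ''Λ' : ∀ (τ : absoluteGaloisGroup E) (hτ : τ ∈ Λ'), τ • Q'' - Q'' = (2 : ℤ) • Ψ τ (hΛ' hτ) := fun τ hτ ↦ by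
    have e1 : τ • Q' - Q' = Ψ τ (hΛ' hτ) := (hψ τ hτ).symm
    have e2 : τ • (c • Q') - c • Q' = Ψ τ (hΛ' hτ) + (τ • tc - tc) := by
      have h : Ψ (c⁻¹ * τ * c) (hcinv τ (hΛ' hτ)) = (c⁻¹ * τ * c) • Q' - Q' := hψ (c⁻¹ * τ * c) (hnorm τ hτ)
      have hτcQ : τ • (c • Q') = c • ((c⁻¹ * τ * c) • Q') := by
        rw [← mul_smul, ← mul_smul]; congr 1; group
      rw [hτcQ, ← smul_sub, ← h, Ψconj τ (hΛ' hτ), htc]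
      abel
    have e3 : τ • Q'' - Q'' = (τ • Q' - Q') + (τ • (c • Q') - c • Q') - (τ • tc - tc) := by
      rw [hQ'', smul_sub, smul_add]; abel
    rw [e3, e1, e2, two_zsmul]
    abel
  -- `P' + cP'` is fixed by all of `Λ`, hence lies in `A`; so `p^{k'+a} Q'' ∈ A` and is `c`-fixed
  have hfixP : ∀ x ∈ Λ', x • (p ^ k' • Q') = p ^ k' • Q' := fun x hx ↦ hA'fix _ hQ'A x hx
  have hsum_fix : ∀ b ∈ localSubgroupOfEmb H ι, b • (p ^ k' • Q' + c • (p ^ k' • Q')) = p ^ k' • Q' + c • (p ^ k' • Q') := by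
    intro b hb
    rcases hcov b hb with hb' | hb'
    · have e : b • (c • (p ^ k' • Q')) = c • ((c⁻¹ * b * c) • (p ^ k' • Q')) := by
        rw [← mul_smul, ← mul_smul]; congr 1; group
      rw [smul_add, hfixP b hb', e, hfixP _ (hnorm b hb')]
    · have e1 : b • (p ^ k' • Q') = c • ((c⁻¹ * b) • (p ^ k' • Q')) := by
        rw [← mul_smul]; congr 1; group
      have e2 : b • (c • (p ^ k' • Q')) = (c * c) • ((c⁻¹ * (c⁻¹ * b) * c) • (p ^ k' • Q')) := by
        rw [← mul_smul, ← mul_smul]; congr 1; group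
      rw [smul_add, e1, hfixP _ hb', e2, hfixP _ (hnorm _ hb'), hfixP _ hcc, add_comm]
  have hsumA : p ^ k' • Q' + c • (p ^ k' • Q') ∈ A := hA'A _ (A'.add_mem hQ'A (hA'c _ hQ'A)) hsum_fix
  have htc0 : ((p : ℤ) ^ (k' + a)) • tc = 0 := by
    rw [pow_add, mul_zsmul, htc, hΨtors c hcΛ, zsmul_zero]
  have hpow : ((p : ℤ) ^ (k' + a)) • Q'' = ((p : ℤ) ^ a) • (p ^ k' • Q' + c • (p ^ k' • Q')) := by
    have hk : ((p : ℤ) ^ k') • Q' = p ^ k' • Q' := by rw [← Nat.cast_pow, natCast_zsmul]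
    rw [hQ'', zsmul_sub, htc0, sub_zero, pow_add, mul_comm, mul_zsmul, zsmul_add, ← hsz c, hk]
  have hpowA : ((p : ℤ) ^ (k' + a)) • Q'' ∈ A := by
    rw [hpow]; exact A.zsmul_mem hsumA _
  have hpowfix : c • (((p : ℤ) ^ (k' + a)) • Q'') = ((p : ℤ) ^ (k' + a)) • Q'' := by
    rw [hpow, hsz, hsum_fix c hcΛ]
  -- (2) the defect cocycle `G(b) = bQ'' − Q'' − 2Ψ(b)` on `Λ`: zero on `Λ'`, the constant `x₀ = G(c)` on `cΛ'`
  have Gmul : ∀ (x y z : absoluteGaloisGroup E) (hz : x * y = z) (hx : x ∈ localSubgroupOfEmb H ι) (hy : y ∈ localSubgroupOfEmb H ι)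
      (hz' : z ∈ localSubgroupOfEmb H ι),
      z • Q'' - Q'' - (2 : ℤ) • Ψ z hz' = (x • Q'' - Q'' - (2 : ℤ) • Ψ x hx) + x • (y • Q'' - Q'' - (2 : ℤ) • Ψ y hy) := by
    intro x y z hz hx hy hz'
    subst hz
    rw [Ψmul x y hx hy hz', mul_smul, smul_sub, smul_sub, hsz, zsmul_add]
    abel
  have GΛ' : ∀ (τ : absoluteGaloisGroup E) (hτ : τ ∈ Λ'), τ • Q'' - Q'' - (2 : ℤ) • Ψ τ (hΛ' hτ) = 0 := fun τ hτ ↦ by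
    rw [hQ''Λ' τ hτ, sub_self]
  set x₀ : localPoints W E := c • Q'' - Q'' - (2 : ℤ) • tc with hx₀
  clear_value x₀
  have hGc : c • Q'' - Q'' - (2 : ℤ) • Ψ c hcΛ = x₀ := by rw [hx₀, htc]
  have hG : ∀ (b : absoluteGaloisGroup E) (hb : b ∈ localSubgroupOfEmb H ι), c⁻¹ * b ∈ Λ' →
      b • Q'' - Q'' - (2 : ℤ) • Ψ b hb = x₀ := fun b hb hb' ↦ by
    have hx : c⁻¹ * b ∈ localSubgroupOfEmb H ι := hΛ' hb'
    rw [Gmul c (c⁻¹ * b) b (by group) hcΛ hx hb, GΛ' _ hb', smul_zero, add_zero, hGc]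
  have hcx₀ : c • x₀ = -x₀ := by
    have h := Gmul c c (c * c) rfl hcΛ hcΛ (hΛ' hcc)
    rw [GΛ' (c * c) hcc, hGc] at h
    rw [eq_neg_iff_add_eq_zero, add_comm, h]
  have hx₀fix : ∀ x ∈ Λ', x • x₀ = x₀ := fun x hx ↦ by
    have hxc : x * c ∈ localSubgroupOfEmb H ι := mul_mem (hΛ' hx) hcΛ
    have key := hG (x * c) hxc (by rw [show c⁻¹ * (x * c) = c⁻¹ * x * c by group]; exact hnorm x hx)
    rw [Gmul x c (x * c) rfl (hΛ' hx) hcΛ hxc, GΛ' x hx, zero_add, hGc] at key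
    exact key
  have hpx₀ : ((p : ℤ) ^ a) • x₀ = c • (((p : ℤ) ^ a) • Q'') - ((p : ℤ) ^ a) • Q'' := by
    rw [hx₀, zsmul_sub, zsmul_sub, hsz, ← mul_zsmul tc, mul_comm, mul_zsmul, htc, hΨtors c hcΛ, zsmul_zero, sub_zero]
  -- Bezout `u·2 + w·p^a = 1` and the `Λ'`-fixed element `y` with `cy − y = x₀`
  have hcop : IsCoprime (2 : ℤ) ((p : ℤ) ^ a) := by
    have h2p : Nat.Coprime 2 (p ^ a) := ((Nat.coprime_primes Nat.prime_two hp.out).2 (Ne.symm hp2)).pow_right a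
    have := Nat.isCoprime_iff_coprime.2 h2p
    simpa using this
  obtain ⟨u, w, huw⟩ := hcop
  have hu2 : ∀ z : localPoints W E, ((p : ℤ) ^ a) • z = 0 → (u * 2) • z = z := fun z hz ↦ by
    have h1 : (u * 2 + w * (p : ℤ) ^ a) • z = z := by rw [huw, one_zsmul]
    rw [add_zsmul, mul_zsmul z w, hz, zsmul_zero, add_zero] at h1
    exact h1
  set y : localPoints W E := (-u) • x₀ + w • (((p : ℤ) ^ a) • Q'') with hy
  clear_value y
  have hcy : c • y - y = x₀ := by
    have e : c • y - y = (u * 2) • x₀ + w • (c • (((p : ℤ) ^ a) • Q'') - ((p : ℤ) ^ a) • Q'') := by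
      rw [hy, smul_add, hsz, hsz, hcx₀, zsmul_neg, neg_zsmul, mul_zsmul x₀ u 2, two_zsmul, zsmul_add, zsmul_sub]
      abel
    rw [e, ← hpx₀, ← mul_zsmul x₀ w, ← add_zsmul, huw, one_zsmul]
  have hyfix : ∀ x ∈ Λ', x • y = y := fun x hx ↦ by
    have hxQ : x • Q'' = Q'' + (2 : ℤ) • Ψ x (hΛ' hx) := by rw [← hQ''Λ' x hx]; abel
    rw [hy, smul_add, hsz, hsz, hx₀fix x hx, hsz x, hxQ, zsmul_add, ← mul_zsmul (Ψ x (hΛ' hx)), mul_comm, mul_zsmul,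
      hΨtors x (hΛ' hx), zsmul_zero, add_zero]
  -- (3) `G = ∂y` on `Λ`, i.e. `2Ψ b = b(Q'' − y) − (Q'' − y)`
  have h2Ψ : ∀ (b : absoluteGaloisGroup E) (hb : b ∈ localSubgroupOfEmb H ι), (2 : ℤ) • Ψ b hb = b • (Q'' - y) - (Q'' - y) := by
    intro b hb
    rcases hcov b hb with hb' | hb'
    · rw [smul_sub, hyfix b hb', ← hQ''Λ' b hb']; abel
    · have h := hG b hb hb'
      have hby : b • y = c • y := by
        rw [show b • y = c • ((c⁻¹ * b) • y) by rw [← mul_smul]; congr 1; group, hyfix _ hb']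
      have e : b • Q'' - Q'' = x₀ + (2 : ℤ) • Ψ b hb := by rw [← h]; abel
      rw [smul_sub, hby, show b • Q'' - c • y - (Q'' - y) = (b • Q'' - Q'') - (c • y - y) by abel, e, hcy]
      abel
  -- the Kummer point `Q = u (Q'' − y)` and its `p^{k'+a}`-multiple
  have hpx : ((p : ℤ) ^ (k' + a)) • x₀ = 0 := by
    rw [hx₀, zsmul_sub, zsmul_sub, ← hsz c, hpowfix, sub_self, zero_sub, neg_eq_zero, ← mul_zsmul tc, mul_comm, mul_zsmul, htc0,
      zsmul_zero]
  have hpy : ((p : ℤ) ^ (k' + a)) • y = w • (((p : ℤ) ^ a) • (((p : ℤ) ^ (k' + a)) • Q'')) := by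
    rw [hy, zsmul_add, ← mul_zsmul x₀, mul_comm, mul_zsmul, hpx, zsmul_zero, zero_add]
    simp only [← mul_zsmul]
    congr 1
    ring
  refine ⟨ψ, u • (Q'' - y), k' + a, rfl, ?_, fun τ ↦ ?_⟩
  · rw [← natCast_zsmul, Nat.cast_pow, ← mul_zsmul, mul_comm, mul_zsmul, zsmul_sub, hpy]
    exact A.zsmul_mem (A.sub_mem hpowA (A.zsmul_mem (A.zsmul_mem hpowA _) _)) _
  · have h := h2Ψ τ τ.2
    have hΨτ : Ψ τ τ.2 = (u * 2) • Ψ τ τ.2 := (hu2 _ (hΨtors τ τ.2)).symm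
    change Ψ τ τ.2 = (τ : absoluteGaloisGroup E) • (u • (Q'' - y)) - u • (Q'' - y)
    rw [hΨτ, mul_zsmul, h, zsmul_sub, ← hsz]

/-- ★★ **The same descent with the TRACE hypothesis** (variant consumed by the concrete half, p765739/p765761): instead of `cA' ⊆ A'` and
«`Λ`-fixed points of `A'` lie in `A`» it suffices that **`P + c•P ∈ A` for every `P ∈ A'`** — the local quadratic trace of a `K_{n,w}`-signed
point is a `ℚ_{n,p}`-signed point (its `ℚ`-tower traces are `R + cR`, `R` the transport of the `K`-tower traces) — together with `A'` being fixed
by `Λ'`; the proof is verbatim (the trace hypothesis is used once, on `P' = p^{k'}Q'`).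
**Quadratic descent of Kobayashi's Kummer condition along an index-`2` local subgroup (D3-W, abstract half, trace form).** Let `Λ = Gal(K̄_E/L_w)` be
the local group of `H` at `ι`, `Λ' ≤ Λ` a subgroup and `c ∈ Λ` with `c² ∈ Λ'`, `c⁻¹Λ'c ⊆ Λ'` and `Λ = Λ' ∪ cΛ'`; let `A, A' ≤ E(K̄_E)` with `cA' ⊆ A'`,
`A'` fixed pointwise by `Λ'`, and every `Λ`-fixed point of `A'` in `A`. If `ψ ∈ Z¹(H, E[p^∞])` is killed by `p^a` (`p` odd) and ON `Λ'` its local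
crossed homomorphism is the Kummer cocycle `τ ↦ τQ' − Q'` of a point with `p^{k'}Q' ∈ A'`, then `[ψ] ∈ localKummerOverOfEmb W p H ι A`: on ALL of `Λ`
it is the Kummer cocycle of a point `Q` with `p^{k'+a}Q ∈ A` (trace `Q' + cQ'`, defect cocycle on `Λ/Λ' ≅ ℤ/2` killed by `2` and by `p^a`, Bezout).
In COUNT_π: `E = ℚ_p`-completion, `H = Gal(ℚ̄/ℚ_n)`, `Λ' = Gal(ℚ̄_p/K_{n,w})`, `A' = E^ε(K_{n,w})`, `A = E^ε(ℚ_{n,p})`, `c` a Frobenius of `K_v/ℚ_p`.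
[cite: Kobayashi2003, Def. 1.1] [cite: BDKim2009, §2 p. 185] [cite: SerreGaloisCohomology1997, I §2.6 (b)] [cite: MilneADT2006, I Prop. 3.8] -/
theorem mem_localKummerOverOfEmb_of_kummer_on_index_two_of_trace (hp2 : p ≠ 2)
    (Λ' : Subgroup (absoluteGaloisGroup E)) (hΛ' : Λ' ≤ localSubgroupOfEmb H ι)
    {c : absoluteGaloisGroup E} (hc : c ∈ localSubgroupOfEmb H ι) (hcc : c * c ∈ Λ')
    (hnorm : ∀ x ∈ Λ', c⁻¹ * x * c ∈ Λ') (hcov : ∀ b ∈ localSubgroupOfEmb H ι, b ∈ Λ' ∨ c⁻¹ * b ∈ Λ')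
    (A A' : AddSubgroup (localPoints W E)) (hA'fix : ∀ P ∈ A', ∀ x ∈ Λ', x • P = P) (hA'tr : ∀ P ∈ A', P + c • P ∈ A)
    (ψ : contOneCocycles (discreteTopRep H (W.geomPrimaryTorsion p))) {a : ℕ} (ha : ∀ x : H, p ^ a • ψ.1 x = 0)
    (Q' : localPoints W E) (k' : ℕ) (hQ'A : p ^ k' • Q' ∈ A')
    (hψ : ∀ (τ : absoluteGaloisGroup E) (hτ : τ ∈ Λ'),
      pointsMapOfEmb W ι ((ψ.1 (resGalSubgroupOfEmb H ι ⟨τ, hΛ' hτ⟩) : W.geomPrimaryTorsion p) : W.geomPoints) = τ • Q' - Q') :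
    oneCocycleClass (discreteTopRep H (W.geomPrimaryTorsion p)) ψ ∈ localKummerOverOfEmb W p H ι A := by
  -- notation: the local crossed homomorphism `Ψ` and its calculus
  set Ψ : ∀ x : absoluteGaloisGroup E, x ∈ localSubgroupOfEmb H ι → localPoints W E :=
    fun x hx ↦ pointsMapOfEmb W ι ((ψ.1 (resGalSubgroupOfEmb H ι ⟨x, hx⟩) : W.geomPrimaryTorsion p) : W.geomPoints) with hΨdef
  have Ψcongr : ∀ (x x' : absoluteGaloisGroup E) (hxx' : x = x') (hx : x ∈ localSubgroupOfEmb H ι) (hx' : x' ∈ localSubgroupOfEmb H ι),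
      Ψ x hx = Ψ x' hx' := by
    intro x x' hxx' hx hx'; subst hxx'; rfl
  have Ψmul : ∀ (x y : absoluteGaloisGroup E) (hx : x ∈ localSubgroupOfEmb H ι) (hy : y ∈ localSubgroupOfEmb H ι)
      (hxy : x * y ∈ localSubgroupOfEmb H ι), Ψ (x * y) hxy = Ψ x hx + x • Ψ y hy :=
    fun x y hx hy hxy ↦ pointsMapOfEmb_cocycle_mul W p H ι ψ x y hx hy hxy
  have hΨtors : ∀ (x : absoluteGaloisGroup E) (hx : x ∈ localSubgroupOfEmb H ι), ((p : ℤ) ^ a) • Ψ x hx = 0 := fun x hx ↦ by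
    rw [← Nat.cast_pow, natCast_zsmul, hΨdef]
    dsimp only
    rw [← map_nsmul, ← AddSubmonoidClass.coe_nsmul, ha, ZeroMemClass.coe_zero, map_zero]
  have hsz : ∀ (g : absoluteGaloisGroup E) (n : ℤ) (P : localPoints W E), g • (n • P) = n • (g • P) := fun g n P ↦
    map_zsmul (DistribSMul.toAddMonoidHom (localPoints W E) g) n P
  have hcΛ : c ∈ localSubgroupOfEmb H ι := hc
  have hcinv : ∀ (τ : absoluteGaloisGroup E), τ ∈ localSubgroupOfEmb H ι → c⁻¹ * τ * c ∈ localSubgroupOfEmb H ι :=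
    fun τ hτ ↦ mul_mem (mul_mem (inv_mem hcΛ) hτ) hcΛ
  -- conjugation: `c • Ψ(c⁻¹ τ c) = Ψ τ + τ • Ψ c − Ψ c`
  have Ψconj : ∀ (τ : absoluteGaloisGroup E) (hτ : τ ∈ localSubgroupOfEmb H ι),
      c • Ψ (c⁻¹ * τ * c) (hcinv τ hτ) = Ψ τ hτ + τ • Ψ c hcΛ - Ψ c hcΛ := fun τ hτ ↦ by
    have h1 := Ψmul c (c⁻¹ * τ * c) hcΛ (hcinv τ hτ) (mul_mem hcΛ (hcinv τ hτ))
    rw [Ψcongr (c * (c⁻¹ * τ * c)) (τ * c) (by group) _ (mul_mem hτ hcΛ), Ψmul τ c hτ hcΛ (mul_mem hτ hcΛ)] at h1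
    rw [eq_sub_iff_add_eq, add_comm, ← h1]
  -- (1) the trace point `Q'' = Q' + cQ' − Ψ c`
  set tc : localPoints W E := Ψ c hcΛ with htc
  set Q'' : localPoints W E := Q' + c • Q' - tc with hQ''
  clear_value tc Q''
  have hQ''Λ' : ∀ (τ : absoluteGaloisGroup E) (hτ : τ ∈ Λ'), τ • Q'' - Q'' = (2 : ℤ) • Ψ τ (hΛ' hτ) := fun τ hτ ↦ by
    have e1 : τ • Q' - Q' = Ψ τ (hΛ' hτ) := (hψ τ hτ).symm
    have e2 : τ • (c • Q') - c • Q' = Ψ τ (hΛ' hτ) + (τ • tc - tc) := by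
      have h : Ψ (c⁻¹ * τ * c) (hcinv τ (hΛ' hτ)) = (c⁻¹ * τ * c) • Q' - Q' := hψ (c⁻¹ * τ * c) (hnorm τ hτ)
      have hτcQ : τ • (c • Q') = c • ((c⁻¹ * τ * c) • Q') := by
        rw [← mul_smul, ← mul_smul]; congr 1; group
      rw [hτcQ, ← smul_sub, ← h, Ψconj τ (hΛ' hτ), htc]
      abel
    have e3 : τ • Q'' - Q'' = (τ • Q' - Q') + (τ • (c • Q') - c • Q') - (τ • tc - tc) := by
      rw [hQ'', smul_sub, smul_add]; abel
    rw [e3, e1, e2, two_zsmul]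
    abel
  -- `P' + cP'` is fixed by all of `Λ`, hence lies in `A`; so `p^{k'+a} Q'' ∈ A` and is `c`-fixed
  have hfixP : ∀ x ∈ Λ', x • (p ^ k' • Q') = p ^ k' • Q' := fun x hx ↦ hA'fix _ hQ'A x hx
  have hsum_fix : ∀ b ∈ localSubgroupOfEmb H ι, b • (p ^ k' • Q' + c • (p ^ k' • Q')) = p ^ k' • Q' + c • (p ^ k' • Q') := by
    intro b hb
    rcases hcov b hb with hb' | hb'
    · have e : b • (c • (p ^ k' • Q')) = c • ((c⁻¹ * b * c) • (p ^ k' • Q')) := by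
        rw [← mul_smul, ← mul_smul]; congr 1; group
      rw [smul_add, hfixP b hb', e, hfixP _ (hnorm b hb')]
    · have e1 : b • (p ^ k' • Q') = c • ((c⁻¹ * b) • (p ^ k' • Q')) := by
        rw [← mul_smul]; congr 1; group
      have e2 : b • (c • (p ^ k' • Q')) = (c * c) • ((c⁻¹ * (c⁻¹ * b) * c) • (p ^ k' • Q')) := by
        rw [← mul_smul, ← mul_smul]; congr 1; group
      rw [smul_add, e1, hfixP _ hb', e2, hfixP _ (hnorm _ hb'), hfixP _ hcc, add_comm]
  have hsumA : p ^ k' • Q' + c • (p ^ k' • Q') ∈ A := hA'tr _ hQ'A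
  have htc0 : ((p : ℤ) ^ (k' + a)) • tc = 0 := by
    rw [pow_add, mul_zsmul, htc, hΨtors c hcΛ, zsmul_zero]
  have hpow : ((p : ℤ) ^ (k' + a)) • Q'' = ((p : ℤ) ^ a) • (p ^ k' • Q' + c • (p ^ k' • Q')) := by
    have hk : ((p : ℤ) ^ k') • Q' = p ^ k' • Q' := by rw [← Nat.cast_pow, natCast_zsmul]
    rw [hQ'', zsmul_sub, htc0, sub_zero, pow_add, mul_comm, mul_zsmul, zsmul_add, ← hsz c, hk]
  have hpowA : ((p : ℤ) ^ (k' + a)) • Q'' ∈ A := by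
    rw [hpow]; exact A.zsmul_mem hsumA _
  have hpowfix : c • (((p : ℤ) ^ (k' + a)) • Q'') = ((p : ℤ) ^ (k' + a)) • Q'' := by
    rw [hpow, hsz, hsum_fix c hcΛ]
  -- (2) the defect cocycle `G(b) = bQ'' − Q'' − 2Ψ(b)` on `Λ`: zero on `Λ'`, the constant `x₀ = G(c)` on `cΛ'`
  have Gmul : ∀ (x y z : absoluteGaloisGroup E) (hz : x * y = z) (hx : x ∈ localSubgroupOfEmb H ι) (hy : y ∈ localSubgroupOfEmb H ι)
      (hz' : z ∈ localSubgroupOfEmb H ι),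
      z • Q'' - Q'' - (2 : ℤ) • Ψ z hz' = (x • Q'' - Q'' - (2 : ℤ) • Ψ x hx) + x • (y • Q'' - Q'' - (2 : ℤ) • Ψ y hy) := by
    intro x y z hz hx hy hz'
    subst hz
    rw [Ψmul x y hx hy hz', mul_smul, smul_sub, smul_sub, hsz, zsmul_add]
    abel
  have GΛ' : ∀ (τ : absoluteGaloisGroup E) (hτ : τ ∈ Λ'), τ • Q'' - Q'' - (2 : ℤ) • Ψ τ (hΛ' hτ) = 0 := fun τ hτ ↦ by
    rw [hQ''Λ' τ hτ, sub_self]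
  set x₀ : localPoints W E := c • Q'' - Q'' - (2 : ℤ) • tc with hx₀
  clear_value x₀
  have hGc : c • Q'' - Q'' - (2 : ℤ) • Ψ c hcΛ = x₀ := by rw [hx₀, htc]
  have hG : ∀ (b : absoluteGaloisGroup E) (hb : b ∈ localSubgroupOfEmb H ι), c⁻¹ * b ∈ Λ' →
      b • Q'' - Q'' - (2 : ℤ) • Ψ b hb = x₀ := fun b hb hb' ↦ by
    have hx : c⁻¹ * b ∈ localSubgroupOfEmb H ι := hΛ' hb'
    rw [Gmul c (c⁻¹ * b) b (by group) hcΛ hx hb, GΛ' _ hb', smul_zero, add_zero, hGc]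
  have hcx₀ : c • x₀ = -x₀ := by
    have h := Gmul c c (c * c) rfl hcΛ hcΛ (hΛ' hcc)
    rw [GΛ' (c * c) hcc, hGc] at h
    rw [eq_neg_iff_add_eq_zero, add_comm, h]
  have hx₀fix : ∀ x ∈ Λ', x • x₀ = x₀ := fun x hx ↦ by
    have hxc : x * c ∈ localSubgroupOfEmb H ι := mul_mem (hΛ' hx) hcΛ
    have key := hG (x * c) hxc (by rw [show c⁻¹ * (x * c) = c⁻¹ * x * c by group]; exact hnorm x hx)
    rw [Gmul x c (x * c) rfl (hΛ' hx) hcΛ hxc, GΛ' x hx, zero_add, hGc] at key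
    exact key
  have hpx₀ : ((p : ℤ) ^ a) • x₀ = c • (((p : ℤ) ^ a) • Q'') - ((p : ℤ) ^ a) • Q'' := by
    rw [hx₀, zsmul_sub, zsmul_sub, hsz, ← mul_zsmul tc, mul_comm, mul_zsmul, htc, hΨtors c hcΛ, zsmul_zero, sub_zero]
  -- Bezout `u·2 + w·p^a = 1` and the `Λ'`-fixed element `y` with `cy − y = x₀`
  have hcop : IsCoprime (2 : ℤ) ((p : ℤ) ^ a) := by
    have h2p : Nat.Coprime 2 (p ^ a) := ((Nat.coprime_primes Nat.prime_two hp.out).2 (Ne.symm hp2)).pow_right a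
    have := Nat.isCoprime_iff_coprime.2 h2p
    simpa using this
  obtain ⟨u, w, huw⟩ := hcop
  have hu2 : ∀ z : localPoints W E, ((p : ℤ) ^ a) • z = 0 → (u * 2) • z = z := fun z hz ↦ by
    have h1 : (u * 2 + w * (p : ℤ) ^ a) • z = z := by rw [huw, one_zsmul]
    rw [add_zsmul, mul_zsmul z w, hz, zsmul_zero, add_zero] at h1
    exact h1
  set y : localPoints W E := (-u) • x₀ + w • (((p : ℤ) ^ a) • Q'') with hy
  clear_value y
  have hcy : c • y - y = x₀ := by
    have e : c • y - y = (u * 2) • x₀ + w • (c • (((p : ℤ) ^ a) • Q'') - ((p : ℤ) ^ a) • Q'') := by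
      rw [hy, smul_add, hsz, hsz, hcx₀, zsmul_neg, neg_zsmul, mul_zsmul x₀ u 2, two_zsmul, zsmul_add, zsmul_sub]
      abel
    rw [e, ← hpx₀, ← mul_zsmul x₀ w, ← add_zsmul, huw, one_zsmul]
  have hyfix : ∀ x ∈ Λ', x • y = y := fun x hx ↦ by
    have hxQ : x • Q'' = Q'' + (2 : ℤ) • Ψ x (hΛ' hx) := by rw [← hQ''Λ' x hx]; abel
    rw [hy, smul_add, hsz, hsz, hx₀fix x hx, hsz x, hxQ, zsmul_add, ← mul_zsmul (Ψ x (hΛ' hx)), mul_comm, mul_zsmul,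
      hΨtors x (hΛ' hx), zsmul_zero, add_zero]
  -- (3) `G = ∂y` on `Λ`, i.e. `2Ψ b = b(Q'' − y) − (Q'' − y)`
  have h2Ψ : ∀ (b : absoluteGaloisGroup E) (hb : b ∈ localSubgroupOfEmb H ι), (2 : ℤ) • Ψ b hb = b • (Q'' - y) - (Q'' - y) := by
    intro b hb
    rcases hcov b hb with hb' | hb'
    · rw [smul_sub, hyfix b hb', ← hQ''Λ' b hb']; abel
    · have h := hG b hb hb'
      have hby : b • y = c • y := by
        rw [show b • y = c • ((c⁻¹ * b) • y) by rw [← mul_smul]; congr 1; group, hyfix _ hb']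
      have e : b • Q'' - Q'' = x₀ + (2 : ℤ) • Ψ b hb := by rw [← h]; abel
      rw [smul_sub, hby, show b • Q'' - c • y - (Q'' - y) = (b • Q'' - Q'') - (c • y - y) by abel, e, hcy]
      abel
  -- the Kummer point `Q = u (Q'' − y)` and its `p^{k'+a}`-multiple
  have hpx : ((p : ℤ) ^ (k' + a)) • x₀ = 0 := by
    rw [hx₀, zsmul_sub, zsmul_sub, ← hsz c, hpowfix, sub_self, zero_sub, neg_eq_zero, ← mul_zsmul tc, mul_comm, mul_zsmul, htc0,
      zsmul_zero]
  have hpy : ((p : ℤ) ^ (k' + a)) • y = w • (((p : ℤ) ^ a) • (((p : ℤ) ^ (k' + a)) • Q'')) := by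
    rw [hy, zsmul_add, ← mul_zsmul x₀, mul_comm, mul_zsmul, hpx, zsmul_zero, zero_add]
    simp only [← mul_zsmul]
    congr 1
    ring
  refine ⟨ψ, u • (Q'' - y), k' + a, rfl, ?_, fun τ ↦ ?_⟩
  · rw [← natCast_zsmul, Nat.cast_pow, ← mul_zsmul, mul_comm, mul_zsmul, zsmul_sub, hpy]
    exact A.zsmul_mem (A.sub_mem hpowA (A.zsmul_mem (A.zsmul_mem hpowA _) _)) _
  · have h := h2Ψ τ τ.2
    have hΨτ : Ψ τ τ.2 = (u * 2) • Ψ τ τ.2 := (hu2 _ (hΨtors τ τ.2)).symm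
    change Ψ τ τ.2 = (τ : absoluteGaloisGroup E) • (u • (Q'' - y)) - u • (Q'' - y)
    rw [hΨτ, mul_zsmul, h, zsmul_sub, ← hsz]

end Descent

end Summit.BirchSwinnertonDyer.BirchSwinnertonDyer.Theorems.SmallImageCharSignedSelmer

end
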